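import Mathlib
import Summits.PneNP.PneNP.Theorems.Nc03AvoidResidualCoreReductionBfsP3
import Summits.PneNP.PneNP.Theorems.Nc03AvoidResidualCoreReductionFlip

/-!
# Route Nc03AvoidResidualCore, item `ResidualCoreReduction` — the solver, XII: packing and flipping as programs

Helper file for `stmt-PneNP-20227` (sequel of `…ReductionBfsP3`; cell pnp-ideate). List-level
counterparts of the greedy cycle packing (`…ReductionPack`) and of the candidate patterns
(`…ReductionFlip`): the seed `seedP`, one packing step on a state `(E, U, col)` of three bit strings
(current edge set, union so far, pattern so far), `M` iterations `packRunP`, hence `packUnionP`,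
`packColP`, and `flipColP`. We prove a loop invariant relating the state after `t` steps to the
recursion defining `Bip.packUnion` / `Bip.packCol` and conclude `packUnionP_rep`, `packColP_eq`,
`flipColP_eq` (agreement on genuine data). Polynomial time is proved in the sequel.
-/

set_option linter.dupNamespace false -- `Summit.PneNP.PneNP.…`: summit = sub-problem name (D-0017 single-conjunct layout)

namespace Summit.PneNP.PneNP.Theorems.Nc03Reduction

open Literature.Computability.Complexity CodeFP

/-! ## Programs -/

/-- The number of edges. -/
def mP (gd : GD) : ℕ := gd.2.length

/-- Some edge of `E` is outside the forest of `E`. -/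
def hasNF (gd : GD) (E : List Bool) : Bool :=
  (List.range (mP gd)).any fun j => E.getD j false && !inForestP gd E j

/-- The seed: the least non-forest edge of `E` (junk `0` if none). -/
def seedP (gd : GD) (E : List Bool) : ℕ :=
  ((List.range (mP gd)).find? fun j => E.getD j false && !inForestP gd E j).getD 0

/-- Membership in the fundamental cycle of `e` in `E`. -/
def zmemP (gd : GD) (E : List Bool) (e j : ℕ) : Bool := decide (j ∈ fcycListP gd E e)

/-- The packing state: `(current edges, union so far, pattern so far)`. -/
abbrev PSt := List Bool × List Bool × List Bool

/-- One packing step. -/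
def packStepP (gd : GD) (st : PSt) : PSt :=
  if hasNF gd st.1 then
    ((List.range (mP gd)).map fun j => st.1.getD j false && !zmemP gd st.1 (seedP gd st.1) j,
     (List.range (mP gd)).map fun j => st.2.1.getD j false || zmemP gd st.1 (seedP gd st.1) j,
     (List.range (mP gd)).map fun j =>
       if zmemP gd st.1 (seedP gd st.1) j then fcolP gd st.1 (seedP gd st.1) j else st.2.2.getD j false)
  else st

/-- The all-`false` bit string over the edges. -/
def zerosP (gd : GD) : List Bool := (List.range (mP gd)).map fun _ => false

/-- The packing run: `t` steps from `(E, ∅, ⊥)`. -/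
def packRunP (gd : GD) (E : List Bool) (t : ℕ) : PSt := (packStepP gd)^[t] (E, zerosP gd, zerosP gd)

/-- The packing union of `E`, as a bit string. -/
def packUnionP (gd : GD) (E : List Bool) : List Bool := (packRunP gd E (mP gd)).2.1

/-- The packing pattern of `E`, as a bit string. -/
def packColP (gd : GD) (E : List Bool) : List Bool := (packRunP gd E (mP gd)).2.2

/-- `P` minus the fundamental cycle of `e`, as a bit string. -/
def sdiffZP (gd : GD) (P : List Bool) (e : ℕ) : List Bool :=
  (List.range (mP gd)).map fun j => P.getD j false && !zmemP gd P e j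

/-- The candidate pattern `flipCol P e b`, as a bit string. -/
def flipColP (gd : GD) (P : List Bool) (e : ℕ) (b : Bool) : List Bool :=
  (List.range (mP gd)).map fun j =>
    if zmemP gd P e j then xor (fcolP gd P e j) b else (packColP gd (sdiffZP gd P e)).getD j false

/-! ## Agreement with `Bip` -/

section Bridge

variable {M K : ℕ} {G : Bip (Fin M) (Fin K)}

/-- The edge count of genuine data. -/
@[simp] theorem mP_gdOf : mP (gdOf G) = M := length_gdOf

/-- Reading a mapped bit string over the edges. -/
theorem getD_map_range (f : ℕ → Bool) (j : Fin M) :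
    ((List.range (mP (gdOf G))).map f).getD j.val false = f j.val := by
  rw [List.getD_eq_getElem?_getD, List.getElem?_map, List.getElem?_range (by rw [mP_gdOf]; exact j.isLt)]
  rfl

variable [NeZero M]

/-- Reading the non-forest test. -/
theorem hasNF_iff {S : Finset (Fin M)} {E : List Bool} (hE : RepE S E) :
    hasNF (gdOf G) E = true ↔ (G.nonForest S).Nonempty := by
  unfold hasNF Bip.nonForest
  rw [mP_gdOf, List.any_eq_true]
  simp only [List.mem_range, Bool.and_eq_true, Bool.not_eq_true']
  constructor
  · rintro ⟨j, hj, h1, h2⟩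
    refine ⟨⟨j, hj⟩, Finset.mem_sdiff.2 ⟨?_, fun hf => ?_⟩⟩
    · have := hE ⟨j, hj⟩; rw [h1] at this; exact of_decide_eq_true this.symm
    · rw [← inForestP_iff hE ⟨j, hj⟩] at hf; rw [hf] at h2; exact Bool.noConfusion h2
  · rintro ⟨j, hj⟩
    obtain ⟨h1, h2⟩ := Finset.mem_sdiff.1 hj
    refine ⟨j.val, j.isLt, by rw [hE j]; exact decide_eq_true h1, ?_⟩
    cases h : inForestP (gdOf G) E j.val
    · rfl
    · exact absurd ((inForestP_iff hE j).1 h) h2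

/-- **Seed**: agreement with `Bip.seed`. -/
theorem seedP_eq {S : Finset (Fin M)} {E : List Bool} (hE : RepE S E) : seedP (gdOf G) E = (G.seed S).val := by
  have key : ∀ j : Fin M, (E.getD j.val false && !inForestP (gdOf G) E j.val) = true ↔ j ∈ G.nonForest S := by
    intro j
    unfold Bip.nonForest
    rw [Finset.mem_sdiff, Bool.and_eq_true, hE j, decide_eq_true_eq, Bool.not_eq_true', ← inForestP_iff hE j,
      Bool.eq_false_iff]
  unfold seedP
  rw [mP_gdOf]
  by_cases h : (G.nonForest S).Nonempty
  · have hs : G.seed S = (G.nonForest S).min' h := by unfold Bip.seed; rw [dif_pos h]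
    have hmem : G.seed S ∈ G.nonForest S := by rw [hs]; exact Finset.min'_mem _ _
    rw [find?_range_eq_some (p := fun j => E.getD j false && !inForestP (gdOf G) E j) (m := (G.seed S).val)
      (G.seed S).isLt ((key _).2 hmem) fun i hi => ?_]
    · rfl
    · cases hc : (E.getD i false && !inForestP (gdOf G) E i)
      · rfl
      · exfalso
        have hi' : i < M := lt_trans hi (G.seed S).isLt
        have hle := Finset.min'_le _ _ ((key ⟨i, hi'⟩).1 hc)
        rw [← hs, Fin.le_def] at hle
        exact absurd hle (by simp only; omega)
  · have hs : G.seed S = default := by unfold Bip.seed; rw [dif_neg h]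
    rw [hs, Fin.default_eq_zero, Fin.val_zero, List.find?_eq_none.2]
    · rfl
    · intro j hj hc
      rw [List.mem_range] at hj
      exact h ⟨⟨j, hj⟩, (key ⟨j, hj⟩).1 hc⟩

/-- Reading cycle membership. -/
theorem zmemP_iff {S : Finset (Fin M)} {E : List Bool} (hE : RepE S E) {e : Fin M} (he : e ∈ S) (j : Fin M) :
    zmemP (gdOf G) E e.val j.val = decide (j ∈ G.fcycle S e) := by
  unfold zmemP
  rw [Bool.eq_iff_iff, decide_eq_true_eq, decide_eq_true_eq, mem_fcycListP hE he]

/-- The loop invariant of the packing run from `S`. -/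
def PInv (S : Finset (Fin M)) (t : ℕ) (st : PSt) : Prop :=
  ∃ St Ut : Finset (Fin M), RepE St st.1 ∧ RepE Ut st.2.1 ∧
    (∀ j : Fin M, j ∈ G.packUnion S ↔ j ∈ Ut ∨ j ∈ G.packUnion St) ∧
    (∀ j : Fin M, G.packCol S j = if j ∈ Ut then st.2.2.getD j.val false else G.packCol St j) ∧
    Disjoint Ut St ∧ (∀ j : Fin M, j ∉ Ut → st.2.2.getD j.val false = false) ∧
    (G.nonForest St = ∅ ∨ St.card + t ≤ S.card)

/-- The invariant holds initially. -/
theorem pinv_zero {S : Finset (Fin M)} {E : List Bool} (hE : RepE S E) :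
    PInv (G := G) S 0 (E, zerosP (gdOf G), zerosP (gdOf G)) := by
  refine ⟨S, ∅, hE, fun j => ?_, fun j => by simp, fun j => by simp, Finset.disjoint_empty_left _,
    fun j _ => ?_, Or.inr le_rfl⟩
  · show (zerosP (gdOf G)).getD j.val false = decide (j ∈ (∅ : Finset (Fin M)))
    unfold zerosP; rw [getD_map_range]; simp
  · show (zerosP (gdOf G)).getD j.val false = false
    unfold zerosP; rw [getD_map_range]

/-- The invariant is preserved by a packing step. -/
theorem pinv_step {S : Finset (Fin M)} {t : ℕ} {st : PSt} (h : PInv (G := G) S t st) :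
    PInv (G := G) S (t + 1) (packStepP (gdOf G) st) := by
  obtain ⟨St, Ut, r1, r2, c1, c2, c3, c4, c5⟩ := h
  by_cases hnf : (G.nonForest St).Nonempty
  · have hh : hasNF (gdOf G) st.1 = true := (hasNF_iff r1).2 hnf
    obtain ⟨heS, heT⟩ := G.seed_spec hnf
    set e := G.seed St with he
    set Z := G.fcycle St e with hZ
    have hseed : seedP (gdOf G) st.1 = e.val := seedP_eq r1
    have hzm : ∀ j : Fin M, zmemP (gdOf G) st.1 (seedP (gdOf G) st.1) j.val = decide (j ∈ Z) := by
      intro j; rw [hseed]; exact zmemP_iff r1 heS j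
    have hfc : ∀ j : Fin M, fcolP (gdOf G) st.1 (seedP (gdOf G) st.1) j.val = G.fcol St e j := by
      intro j; rw [hseed]; exact fcolP_eq r1 heS j
    unfold packStepP
    rw [if_pos hh]
    refine ⟨St \ Z, Ut ∪ Z, fun j => ?_, fun j => ?_, fun j => ?_, fun j => ?_, ?_, fun j hj => ?_, Or.inr ?_⟩
    · show ((List.range (mP (gdOf G))).map _).getD j.val false = _
      rw [getD_map_range]
      rw [r1 j, hzm j]
      by_cases h1 : j ∈ St <;> by_cases h2 : j ∈ Z <;> simp [h1, h2, Finset.mem_sdiff]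
    · show ((List.range (mP (gdOf G))).map _).getD j.val false = _
      rw [getD_map_range]
      rw [r2 j, hzm j]
      by_cases h1 : j ∈ Ut <;> by_cases h2 : j ∈ Z <;> simp [h1, h2, Finset.mem_union]
    · rw [c1 j, G.packUnion_of_nonempty hnf, ← he, ← hZ, Finset.mem_union, Finset.mem_union, or_assoc]
    · show _ = if j ∈ Ut ∪ Z then ((List.range (mP (gdOf G))).map _).getD j.val false else _
      rw [getD_map_range, c2 j, G.packCol_of_nonempty hnf, ← he, ← hZ]
      rw [hzm j, hfc j]
      by_cases h1 : j ∈ Ut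
      · have h2 : j ∉ Z := fun h2 => Finset.disjoint_left.1 c3 h1 (G.fcycle_subset heS h2)
        simp [h1, h2, Finset.mem_union]
      · by_cases h2 : j ∈ Z <;> simp [h1, h2, Finset.mem_union]
    · rw [Finset.disjoint_union_left]
      exact ⟨Finset.disjoint_of_subset_right Finset.sdiff_subset c3, Finset.disjoint_sdiff⟩
    · show ((List.range (mP (gdOf G))).map _).getD j.val false = false
      rw [getD_map_range]
      rw [Finset.mem_union, not_or] at hj
      rw [hzm j]
      have h4 := c4 j hj.1
      simp only [hj.2, decide_false, Bool.false_eq_true, if_false]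
      exact h4
    · rcases c5 with c5 | c5
      · exact absurd (Finset.nonempty_iff_ne_empty.1 hnf) (by rw [c5]; simp)
      · have := G.card_sdiff_fcycle_lt hnf
        rw [← he, ← hZ] at this; omega
  · have hh : hasNF (gdOf G) st.1 = false := by
      cases h : hasNF (gdOf G) st.1
      · rfl
      · exact absurd ((hasNF_iff r1).1 h) hnf
    unfold packStepP
    rw [hh]
    exact ⟨St, Ut, r1, r2, c1, c2, c3, c4, Or.inl (Finset.not_nonempty_iff_eq_empty.1 hnf)⟩

/-- The invariant along the run. -/
theorem pinv_run {S : Finset (Fin M)} {E : List Bool} (hE : RepE S E) (t : ℕ) :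
    PInv (G := G) S t (packRunP (gdOf G) E t) := by
  induction t with
  | zero => exact pinv_zero hE
  | succ t ih =>
    unfold packRunP at ih ⊢
    rw [Function.iterate_succ_apply']
    exact pinv_step ih

/-- After `M` steps the packing is finished: the current edge set has no non-forest edge. -/
theorem run_done {S : Finset (Fin M)} {E : List Bool} (hE : RepE S E) :
    ∃ St Ut : Finset (Fin M), RepE Ut (packUnionP (gdOf G) E) ∧ ¬ (G.nonForest St).Nonempty ∧
      (∀ j : Fin M, j ∈ G.packUnion S ↔ j ∈ Ut ∨ j ∈ G.packUnion St) ∧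
      (∀ j : Fin M, G.packCol S j = if j ∈ Ut then (packColP (gdOf G) E).getD j.val false else G.packCol St j) ∧
      (∀ j : Fin M, j ∉ Ut → (packColP (gdOf G) E).getD j.val false = false) := by
  obtain ⟨St, Ut, -, r2, c1, c2, -, c4, c5⟩ := pinv_run (G := G) hE M
  refine ⟨St, Ut, ?_, ?_, c1, ?_, ?_⟩
  · unfold packUnionP; rw [mP_gdOf]; exact r2
  · rw [Finset.not_nonempty_iff_eq_empty]
    rcases c5 with c5 | c5
    · exact c5
    · have hS : S.card ≤ M := by simpa using Finset.card_le_univ S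
      have : St = ∅ := Finset.card_eq_zero.1 (by omega)
      rw [this]; unfold Bip.nonForest; simp
  · unfold packColP; rw [mP_gdOf]; exact c2
  · unfold packColP; rw [mP_gdOf]; exact c4

/-- **The packing union bit string represents `Bip.packUnion`.** -/
theorem packUnionP_rep {S : Finset (Fin M)} {E : List Bool} (hE : RepE S E) :
    RepE (G.packUnion S) (packUnionP (gdOf G) E) := by
  obtain ⟨St, Ut, r2, hnf, c1, -, -⟩ := run_done (G := G) hE
  intro j
  rw [r2 j]
  apply Bool.eq_iff_iff.2
  rw [decide_eq_true_eq, decide_eq_true_eq, c1 j, G.packUnion_of_empty hnf]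
  simp

/-- **The packing pattern bit string agrees with `Bip.packCol`.** -/
theorem packColP_eq {S : Finset (Fin M)} {E : List Bool} (hE : RepE S E) (j : Fin M) :
    (packColP (gdOf G) E).getD j.val false = G.packCol S j := by
  obtain ⟨St, Ut, -, hnf, -, c2, c4⟩ := run_done (G := G) hE
  rw [c2 j, G.packCol_of_empty hnf]
  by_cases h : j ∈ Ut
  · rw [if_pos h]
  · rw [if_neg h, c4 j h]

/-- `P` minus the cycle represents the set difference. -/
theorem sdiffZP_rep {P : Finset (Fin M)} {PL : List Bool} (hP : RepE P PL) {e : Fin M} (he : e ∈ P) :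
    RepE (P \ G.fcycle P e) (sdiffZP (gdOf G) PL e.val) := by
  intro j
  unfold sdiffZP
  rw [getD_map_range]
  rw [hP j, zmemP_iff hP he]
  by_cases h1 : j ∈ P <;> by_cases h2 : j ∈ G.fcycle P e <;> simp [h1, h2, Finset.mem_sdiff]

/-- **The candidate pattern bit string agrees with `Bip.flipCol`.** -/
theorem flipColP_eq {P : Finset (Fin M)} {PL : List Bool} (hP : RepE P PL) {e : Fin M} (he : e ∈ P) (b : Bool)
    (j : Fin M) : (flipColP (gdOf G) PL e.val b).getD j.val false = G.flipCol P e b j := by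
  unfold flipColP Bip.flipCol
  rw [getD_map_range]
  rw [zmemP_iff hP he, fcolP_eq hP he, packColP_eq (sdiffZP_rep hP he)]
  by_cases h : j ∈ G.fcycle P e <;> simp [h]

omit [NeZero M] in
/-- The candidate pattern bit string has length `M`. -/
@[simp] theorem length_flipColP (PL : List Bool) (e : ℕ) (b : Bool) :
    (flipColP (gdOf G) PL e b).length = M := by
  unfold flipColP; rw [List.length_map, List.length_range, mP_gdOf]

end Bridge

end Summit.PneNP.PneNP.Theorems.Nc03Reduction
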